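import Literature.AlgebraicGeometry.AbelianSchemes.AbelianSchemeKOfLUnramified
import Literature.AlgebraicGeometry.Deformation.DualNumberSectionsSplitting
import Literature.AlgebraicGeometry.Deformation.TrivialDeformationSplitThickening
import Literature.AlgebraicGeometry.HodgeTheory.TangentSheafSectionsDerivations
import Literature.AlgebraicGeometry.Modules.CechPicOfLocalRing
import HarnessLib

/-!
# A first-order flow on an abelian scheme fixing the class of a nondegenerate rigidified `L` is the projection:
# `u_D ∈ K(L)(k[ε])` and `K(L)` unramified force `u_D = e` (Mumford, *Abelian Varieties* §13, proof of the Theorem)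

Layer `Literature/AlgebraicGeometry/AbelianSchemes`, namespace `Literature.AlgebraicGeometry.AbelianSchemes`.  THEOREMS ONLY
(no definition, no named fact, no instance, no notation, no `sorry`).  Cell `hodgecm-mathlib` (D-0151), F-11 α1-(iii-c-2),
WAVE-4 ask (W4-2) (I2-a) «`φ_L : Lie(A) → Ȟ¹(𝔘, 𝒪_A)` is injective», the CORE of letter (δ) of the seam `SOCKETS-I2a-seam.v0`
(B-p08 (g16) / B-p06 (g15)): everything of (δ) that does not depend on the construction of the flow ((α)) or on rigidity ((β)),
which enter as the hypotheses `h0`/`happ` and `hβ`; the class identity of (γ) (★ `FirstOrderTranslateClassOfDlogCoboundary`)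
enters as `hγ`.

SETTING ([MumfordAV1970] §13 pp. 125–130; [GortzWedhorn2023] Prop. 27.122, Rem. 27.18 (4)).  `k` a field, `T = Spec k[ε]` over
`Spec k` (the tree's `(ArtAlg.sqZeroExt k).specOver`), `A` an abelian scheme over `Spec k`, `A[ε] = (A.X ⊗ T).left`, `p = fst A.X T`,
`t = deformationParam A.X`, `Φ : A.X ⊗ T ⟶ A.X` an `S`-morphism which is the identity on the closed fibre (`h0`), and
`u := (e, 𝟙) ≫ Φ : T ⟶ A.X` its value at the origin.

* §1 `closedPt_comp_originLift_comp_eq_one` — `u` lies over the origin: along the closed point `Spec k → T`, `u` restricts to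
  the unit point (from `h0`); `isClosedImmersion_closedPt_left`, `isNilpotent_ker_closedPt_left` — the closed point is a
  nilpotent thickening (★ `isFirstOrderThickening_of_isPullback`).
* §2 **`memKOfL_originLift_of_cechPic_pullback_eq`** — if `Φ` is the translation by `u` (`hβ : (A ◁ u) ≫ μ = Φ`) and
  `Φ^*[L] = p^*[L]` (`hγ`), then `u ∈ K(L)(T)` (★ `pullback_whiskerLeft_mumfordClass_eq_one_iff`: `[t_u^*L_T] = [L_T]·[p_T^*u^*L]`
  with `Ȟ¹(Spec k[ε], 𝒪^×) = 1`, ★ `CechPic.pullback_eq_one_of_isLocalRing`).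
* §3 **`originLift_eq_one_of_memKOfL`** — for `k` of characteristic `0` and `L` rigidified and fibrewise of an ample class,
  `u ∈ K(L)(T)` forces `u = e`: `K(L)` is represented by a closed subscheme FORMALLY UNRAMIFIED over `Spec k`
  (★ `exists_kOfL_formallyUnramified`), and a `T`-point of an unramified `k`-scheme is determined by its restriction to the
  closed point (Mathlib `FormallyUnramified.hom_ext`, [StacksProject, Tag 04F1]);
  **`flow_eq_fst_of_cechPic_pullback_eq`** — hence `Φ = p` (`(A ◁ e) ≫ μ = p`).
* §4 (generic, any `k`-scheme) **`vectorField_eq_zero_of_flow_eq_fst`** — if a morphism with the SECTION FORMULA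
  `Φ♯ f = p♯ f + t · p♯(D(df))` of a global vector field `D` IS the projection, then `D = 0`: `t · p♯(D(df)) = 0` forces
  `D(df) = 0` (uniqueness of the splitting `s = p♯μ + t·p♯η` of sections of `𝒪_{X[ε]}`, ★ `Deformation/DualNumberSectionsSplitting`),
  on affine opens a section of `𝒯 = 𝓗om(Ω¹, 𝒪)` is determined by the `D(df)` (★ `tangentSheaf_section_eq_zero_iff_of_isAffineOpen`),
  and `𝒪` is a sheaf.
* §5 **`vectorField_eq_zero_of_flow_of_cechPic_pullback_eq`** — the assembled core of (δ).

HC_CM is proved only modulo the 7 printed citations until rung 0 closes; this file is generic abelian-scheme geometry and asserts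
nothing about HC.

## References
* [MumfordAV1970] D. Mumford, *Abelian Varieties* (1970), §13, proof of the Theorem (pp. 125–130).
* [GortzWedhorn2023] U. Görtz, T. Wedhorn, *Algebraic Geometry II* (2023), Prop. 27.122, Rem. 27.18 (4).
* [GortzWedhorn2020] U. Görtz, T. Wedhorn, *Algebraic Geometry I*, 2nd ed. (2020), (6.3)–(6.4) (tangent vectors as `k[ε]`-points).
* [StacksProject] The Stacks Project, Tag 04F1 (formally unramified: uniqueness of infinitesimal lifts).
* [Hartshorne2010] R. Hartshorne, *Deformation Theory* (2010), §2, proof of Prop. 2.6 (pp. 13–14).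
-/

noncomputable section

-- `(X ⊗ T).left = pullback X.hom T.hom` / `Scheme.Modules` are not reducible (as in ★ `TrivialDeformationIdealSheaf`).
set_option backward.isDefEq.respectTransparency false

open CategoryTheory CategoryTheory.Limits AlgebraicGeometry Opposite TopologicalSpace MonoidalCategory
  CartesianMonoidalCategory

namespace Literature.AlgebraicGeometry.AbelianSchemes

open Literature.AlgebraicGeometry.Motives Literature.AlgebraicGeometry.Modules
  Literature.AlgebraicGeometry.Morphisms Literature.AlgebraicGeometry.HodgeTheory Literature.AlgebraicGeometry.Deformation

open Literature.AlgebraicGeometry.FormalGeometry.WittGrothendieckExistence.PadicPridhamSemiregularity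
  (isFirstOrderThickening_of_isPullback)

variable {k : Type} [Field k]

/-! ## §1 The closed point of `T = Spec k[ε]` and the value of a flow at the origin -/

section ClosedPoint

open scoped MonObj

/-- The structure map followed by the residue: `Spec(residue) ≫ Spec(k → k[ε]) = 𝟙`. [cite: GortzWedhorn2020, (6.3)–(6.4)] -/
theorem specMap_residue_comp_hom :
    Spec.map (CommRingCat.ofHom (ArtAlg.sqZeroExt (k := k) k).residue.toRingHom) ≫
        (ArtAlg.sqZeroExt (k := k) k).specOver.hom = 𝟙 _ := by
  change Spec.map _ ≫ Spec.map _ = 𝟙 _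
  rw [← Spec.map_comp, ← CommRingCat.ofHom_comp, ArtAlg.residue_toRingHom_comp_algebraMap, CommRingCat.ofHom_id,
    Spec.map_id]

/-- There is a closed point `Spec k → T` over `Spec k` with underlying map `Spec(residue)` (existential packaging, no
definition). [cite: GortzWedhorn2020, (6.3)–(6.4)] -/
theorem exists_closedPt : ∃ pt : 𝟙_ (Motives.SchemeOver k) ⟶ (ArtAlg.sqZeroExt (k := k) k).specOver,
    pt.left = Spec.map (CommRingCat.ofHom (ArtAlg.sqZeroExt (k := k) k).residue.toRingHom) :=
  ⟨Over.homMk (Spec.map (CommRingCat.ofHom (ArtAlg.sqZeroExt (k := k) k).residue.toRingHom))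
    (by rw [specMap_residue_comp_hom]; rfl), rfl⟩

/-- The closed point `Spec k → Spec k[ε]` is a first-order thickening. [cite: StacksProject, Tag 04F1] -/
theorem isFirstOrderThickening_specMap_residue :
    IsFirstOrderThickening (Spec.map (CommRingCat.ofHom (ArtAlg.sqZeroExt (k := k) k).residue.toRingHom)) := by
  have hK : RingHom.ker (ArtAlg.sqZeroExt (k := k) k).residue.toRingHom *
      RingHom.ker (ArtAlg.sqZeroExt (k := k) k).residue.toRingHom = ⊥ := by
    rw [ArtAlg.ker_residue, ArtAlg.sqZeroExt_maximalIdeal_mul_self]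
  have sq : CommSq (Spec.map (CommRingCat.ofHom (ArtAlg.sqZeroExt (k := k) k).residue.toRingHom)) (𝟙 (Spec (.of k)))
      (𝟙 (Spec (.of (ArtAlg.sqZeroExt (k := k) k)))) (Spec.map (CommRingCat.ofHom (ArtAlg.sqZeroExt (k := k) k).residue.toRingHom)) :=
    ⟨by rw [Category.id_comp, Category.comp_id]⟩
  exact isFirstOrderThickening_of_isPullback (φ := (ArtAlg.sqZeroExt (k := k) k).residue.toRingHom)
    (ArtAlg.residue_surjective _) hK (IsPullback.of_vert_isIso sq)

variable (A : AbelianSchemeOver (Spec (.of k)))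
  (Φ : A.X ⊗ (ArtAlg.sqZeroExt (k := k) k).specOver ⟶ A.X)
  (h0 : closedFibreι A.X (ArtAlg.sqZeroExt (k := k) k) ≫ Φ.left = 𝟙 A.left)

/-- The point `(e, pt) : Spec k → A[ε]` is the unit point followed by the closed fibre. [cite: GortzWedhorn2020, (6.3)–(6.4)] -/
theorem lift_unit_closedPt_left (pt : 𝟙_ (Motives.SchemeOver k) ⟶ (ArtAlg.sqZeroExt (k := k) k).specOver)
    (hpt : pt.left = Spec.map (CommRingCat.ofHom (ArtAlg.sqZeroExt (k := k) k).residue.toRingHom)) :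
    (lift η[A.X] pt).left = η[A.X].left ≫ closedFibreι A.X (ArtAlg.sqZeroExt (k := k) k) := by
  rw [Over.lift_left]
  apply pullback.hom_ext
  · rw [pullback.lift_fst, Category.assoc, closedFibreι_fst, Category.comp_id]
  · rw [pullback.lift_snd, Category.assoc, closedFibreι_snd, ← Category.assoc, hpt, Over.w η[A.X]]
    exact (Category.id_comp _).symm

include h0 in
/-- **`u` lies over the origin**: along the closed point, `u = (e, 𝟙) ≫ Φ` restricts to the unit point (`Φ` is the identity on
the closed fibre). [cite: MumfordAV1970, §13, proof of the Theorem (p. 125)] -/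
theorem closedPt_comp_originLift_comp_eq_one (pt : 𝟙_ (Motives.SchemeOver k) ⟶ (ArtAlg.sqZeroExt (k := k) k).specOver)
    (hpt : pt.left = Spec.map (CommRingCat.ofHom (ArtAlg.sqZeroExt (k := k) k).residue.toRingHom)) :
    pt ≫ (lift (toUnit _ ≫ η[A.X]) (𝟙 _) ≫ Φ) = 1 := by
  have hl : pt ≫ lift (toUnit _ ≫ η[A.X]) (𝟙 _) = lift η[A.X] pt := by
    ext
    · rw [Category.assoc, lift_fst, lift_fst, ← Category.assoc, toUnit_unique (pt ≫ toUnit _) (𝟙 _), Category.id_comp]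
    · rw [Category.assoc, lift_snd, lift_snd, Category.comp_id]
  rw [← Category.assoc, hl, Hom.one_def, toUnit_unique (toUnit (𝟙_ (Motives.SchemeOver k))) (𝟙 _), Category.id_comp]
  ext
  rw [Over.comp_left, lift_unit_closedPt_left A pt hpt, Category.assoc, h0, Category.comp_id]

end ClosedPoint

/-! ## §2 Translation + class identity ⇒ `u ∈ K(L)(T)` -/

section Mem

open scoped MonObj

variable (A : AbelianSchemeOver (Spec (.of k))) {L : A.left.Modules} (hL : HasRank L 1)
  (Φ : A.X ⊗ (ArtAlg.sqZeroExt (k := k) k).specOver ⟶ A.X)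
  (hβ : (A.X ◁ (lift (toUnit _ ≫ η[A.X]) (𝟙 _) ≫ Φ)) ≫ μ[A.X] = Φ)
  (hγ : CechPic.pullback Φ.left (detClass (HasRank.isFiniteLocallyFree' hL)) =
    CechPic.pullback (fst A.X (ArtAlg.sqZeroExt (k := k) k).specOver).left (detClass (HasRank.isFiniteLocallyFree' hL)))

include hβ hγ in
/-- **`u ∈ K(L)(k[ε])`**: if `Φ` is the translation by `u` and `Φ^*[L] = p^*[L]`, then `(1 × u)^*Λ(L)` is trivial — the
membership criterion `[t_u^*L_T] = [L_T] · [p_T^*(u^*L)]` (★ `pullback_whiskerLeft_mumfordClass_eq_one_iff`) with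
`[u^*L] = 1` in `Ȟ¹(Spec k[ε], 𝒪^×) = 1` (a local ring). [cite: MumfordAV1970, §13 (p. 123) and proof of the Theorem (p. 125)] -/
theorem memKOfL_originLift_of_cechPic_pullback_eq : A.MemKOfL L (lift (toUnit _ ≫ η[A.X]) (𝟙 _) ≫ Φ) := by
  have h1 : CechPic.pullback (lift (toUnit _ ≫ η[A.X]) (𝟙 _) ≫ Φ).left (detClass (HasRank.isFiniteLocallyFree' hL)) = 1 :=
    CechPic.pullback_eq_one_of_isLocalRing (R := CommRingCat.of (ArtAlg.sqZeroExt (k := k) k)) _ _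
  rw [A.memKOfL_iff_mumfordClass hL, A.pullback_whiskerLeft_mumfordClass_eq_one_iff, hβ, hγ,
    AbelianSchemeOver.pullback_comp_left, h1, map_one, mul_one]

end Mem

/-! ## §3 `K(L)` unramified ⇒ `u = e` ⇒ `Φ = p` -/

section Unramified

open scoped MonObj

variable (A : AbelianSchemeOver (Spec (.of k))) {L : A.left.Modules} (hL : HasRank L 1)
  (hε : CechPic.pullback A.unitSection (detClass (HasRank.isFiniteLocallyFree' hL)) = 1)
  (hΘ : ∀ ⦃Ω : Type⦄ [Field Ω] [IsAlgClosed Ω] (s : Spec (.of Ω) ⟶ Spec (.of k)),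
    ∃ Θ : CartierDivisor (A.fibre s).toAbelianVariety.X.left, Θ.IsAmple ∧
      CechPic.pullback (X := (A.fibre s).toAbelianVariety.X.left) (pullback.fst A.X.hom s)
        (detClass (HasRank.isFiniteLocallyFree' hL)) = Θ.cechClass)

/-- **A `T`-point of a formally unramified `k`-scheme is determined by its restriction to the closed point** (uniqueness of
infinitesimal lifts, Mathlib `FormallyUnramified.hom_ext`): it is the constant point through its reduction.
[cite: StacksProject, Tag 04F1] [cite: GortzWedhorn2020, (6.3)–(6.4)] -/
theorem eq_toUnit_comp_closedPt_comp_of_formallyUnramified {Z : Motives.SchemeOver k} (hZ : FormallyUnramified Z.hom)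
    (pt : 𝟙_ (Motives.SchemeOver k) ⟶ (ArtAlg.sqZeroExt (k := k) k).specOver)
    (hpt : pt.left = Spec.map (CommRingCat.ofHom (ArtAlg.sqZeroExt (k := k) k).residue.toRingHom))
    (v : (ArtAlg.sqZeroExt (k := k) k).specOver ⟶ Z) : v = toUnit _ ≫ pt ≫ v := by
  haveI := hZ
  haveI : IsFirstOrderThickening pt.left := by rw [hpt]; exact isFirstOrderThickening_specMap_residue
  have hnil : IsNilpotent pt.left.ker :=
    ⟨2, by rw [pow_two, IsFirstOrderThickening.ker_mul_ker_eq_bot]; rfl⟩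
  have hpt1 : pt.left ≫ (toUnit (ArtAlg.sqZeroExt (k := k) k).specOver).left = 𝟙 _ := by
    rw [← Over.comp_left, toUnit_unique (pt ≫ toUnit _) (𝟙 _), Over.id_left]
  ext
  refine FormallyUnramified.hom_ext pt.left hnil Z.hom ?_ ?_
  · rw [Over.comp_left, Over.comp_left, ← Category.assoc, ← Category.assoc, hpt1, Category.id_comp]
  · rw [Over.w, Over.w]

variable [CharZero k]

include hε hΘ in
/-- **`u ∈ K(L)(k[ε])` over the origin ⇒ `u = e`** (`k` of characteristic `0`): `K(L)` is a closed subscheme `Z ↪ A`, finite and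
FORMALLY UNRAMIFIED over `Spec k` (★ `exists_kOfL_formallyUnramified`: Deligne's `[n]` kills a finite subgroup, `[n]` étale in
characteristic `0`); `u` factors through `Z`, and a `k[ε]`-point of an unramified `k`-scheme is constant
(`eq_toUnit_comp_closedPt_comp_of_formallyUnramified`), so `u = (T → Spec k) ≫ (pt ≫ u) = (T → Spec k) ≫ e = e`.
[cite: MumfordAV1970, §13, proof of the Theorem (pp. 125–130)] [cite: GortzWedhorn2023, Prop. 27.122 and Rem. 27.18 (4)] -/
theorem originLift_eq_one_of_memKOfL (u : (ArtAlg.sqZeroExt (k := k) k).specOver ⟶ A.X)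
    (pt : 𝟙_ (Motives.SchemeOver k) ⟶ (ArtAlg.sqZeroExt (k := k) k).specOver)
    (hpt : pt.left = Spec.map (CommRingCat.ofHom (ArtAlg.sqZeroExt (k := k) k).residue.toRingHom))
    (hu1 : pt ≫ u = 1) (hu : A.MemKOfL L u) : u = 1 := by
  obtain ⟨Z, i, _, _, hZ, hZK⟩ := A.exists_kOfL_formallyUnramified hL hε hΘ
  obtain ⟨v, hv⟩ := (hZK _ u).mpr hu
  rw [← hv, eq_toUnit_comp_closedPt_comp_of_formallyUnramified hZ pt hpt v, Category.assoc, Category.assoc, hv, hu1,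
    MonObj.comp_one]

variable (Φ : A.X ⊗ (ArtAlg.sqZeroExt (k := k) k).specOver ⟶ A.X)
  (h0 : closedFibreι A.X (ArtAlg.sqZeroExt (k := k) k) ≫ Φ.left = 𝟙 A.left)
  (hβ : (A.X ◁ (lift (toUnit _ ≫ η[A.X]) (𝟙 _) ≫ Φ)) ≫ μ[A.X] = Φ)
  (hγ : CechPic.pullback Φ.left (detClass (HasRank.isFiniteLocallyFree' hL)) =
    CechPic.pullback (fst A.X (ArtAlg.sqZeroExt (k := k) k).specOver).left (detClass (HasRank.isFiniteLocallyFree' hL)))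

include hε hΘ h0 hβ hγ in
/-- **The flow is the projection**: a first-order flow `Φ` of the identity on an abelian scheme over a field of characteristic
`0` which is the translation by its value `u` at the origin (`hβ`) and fixes the class of a rigidified, fibrewise-ample rank-one
`L` (`hγ`: `Φ^*[L] = p^*[L]`) is `p`: `u ∈ K(L)(k[ε])` by §2, `u = e` by `originLift_eq_one_of_memKOfL`, and
`(A ◁ e) ≫ μ = p`. [cite: MumfordAV1970, §13, proof of the Theorem (pp. 125–130)] [cite: GortzWedhorn2023, Prop. 27.122 and Rem. 27.18 (4)] -/
theorem flow_eq_fst_of_cechPic_pullback_eq : Φ = fst A.X (ArtAlg.sqZeroExt (k := k) k).specOver := by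
  obtain ⟨pt, hpt⟩ := exists_closedPt (k := k)
  have hu : lift (toUnit _ ≫ η[A.X]) (𝟙 _) ≫ Φ = 1 :=
    originLift_eq_one_of_memKOfL A hL hε hΘ _ pt hpt (closedPt_comp_originLift_comp_eq_one A Φ h0 pt hpt)
      (memKOfL_originLift_of_cechPic_pullback_eq A hL Φ hβ hγ)
  rw [← hβ, hu, A.whiskerLeft_comp_mul_eq, MonObj.comp_one, mul_one]

end Unramified

/-! ## §4 Generic: a flow with the section formula which IS the projection has vanishing vector field -/

section VectorField

variable (X : Motives.SchemeOver k) (D : (cotangentSheaf X).over ⊤ ⟶ (unitModule X.left).over ⊤)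
  (Φ : X ⊗ (ArtAlg.sqZeroExt (k := k) k).specOver ⟶ X)
  (happ : ∀ (U : X.left.Opens) (V : (X ⊗ (ArtAlg.sqZeroExt (k := k) k).specOver).left.Opens)
      (h₁ : V ≤ Φ.left ⁻¹ᵁ U) (h₂ : V ≤ (fst X (ArtAlg.sqZeroExt (k := k) k).specOver).left ⁻¹ᵁ U)
      (f : Γ(X.left, U)),
      Φ.left.appLE U V h₁ f =
        (fst X (ArtAlg.sqZeroExt (k := k) k).specOver).left.appLE U V h₂ f +
          sectionOn (deformationParam X) V *
            (fst X (ArtAlg.sqZeroExt (k := k) k).specOver).left.appLE U V h₂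
              (show Γ(X.left, U) from appLE D (homOfLE le_top) (dSection X U f)))

/-- **`t · p♯ η = 0 ⇒ η = 0`** on `X[ε] = X × Spec k[ε]`: uniqueness of the splitting `s = p♯ μ + t · p♯ η` of sections of
`𝒪_{X[ε]}` over `p⁻¹ U` (★ `Deformation/DualNumberSectionsSplitting`, `t` a flat parameter).
[cite: Hartshorne2010, §2 proof of Prop. 2.6, pp. 13–14] -/
theorem eq_zero_of_sectionOn_deformationParam_mul_app_eq_zero (U : X.left.Opens) (y : Γ(X.left, U))
    (h : sectionOn (deformationParam X) ((fst X (ArtAlg.sqZeroExt (k := k) k).specOver).left ⁻¹ᵁ U) *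
      (fst X (ArtAlg.sqZeroExt (k := k) k).specOver).left.app U y = 0) : y = 0 := by
  haveI := isFirstOrderThickening_closedFibreι_dualNumber X
  set i := closedFibreι X (ArtAlg.sqZeroExt (k := k) k) with hi
  set p := (fst X (ArtAlg.sqZeroExt (k := k) k).specOver).left with hp
  have hip : i ≫ p = 𝟙 _ := closedFibreι_fst X _
  have hU : i ⁻¹ᵁ (p ⁻¹ᵁ U) = U := by
    rw [← Scheme.Hom.comp_preimage, hip]; rfl
  -- transport `y` to `Γ(X, i⁻¹(p⁻¹ U))`
  have key := eq_of_retractionApp_add_deformationParam_mul_eq' X (p ⁻¹ᵁ U) 0 0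
    (X.left.presheaf.map (eqToHom hU).op y) 0 ?_
  · have h2 := key.2
    have hiso : Function.Injective (X.left.presheaf.map (eqToHom hU).op) :=
      (ConcreteCategory.bijective_of_isIso (X.left.presheaf.map (eqToHom hU).op)).1
    exact hiso (h2.trans (map_zero _).symm)
  · rw [map_zero, mul_zero, zero_add, add_zero, retractionApp_def, ← CommRingCat.comp_apply, Scheme.Hom.map_appLE']
    rw [Scheme.Hom.app_eq_appLE] at h
    exact h

include happ in
/-- **Section formula + `Φ = p` ⇒ `D(df) = 0`** for every section `f` of `𝒪_X` over every open `U`.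
[cite: MumfordAV1970, §13, proof of the Theorem (p. 125)] -/
theorem appLE_dSection_eq_zero_of_flow_eq_fst (hΦ : Φ = fst X (ArtAlg.sqZeroExt (k := k) k).specOver)
    (U : X.left.Opens) (f : Γ(X.left, U)) :
    (show Γ(X.left, U) from appLE D (homOfLE le_top) (dSection X U f)) = 0 := by
  subst hΦ
  refine eq_zero_of_sectionOn_deformationParam_mul_app_eq_zero X U _ ?_
  have h := happ U _ le_rfl le_rfl f
  rw [← Scheme.Hom.app_eq_appLE] at h
  exact (add_eq_left.mp h.symm)

/-- **A global vector field with `D(df) = 0` for all local sections `f` is zero**: on each affine open `V` the restriction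
`D|_V` vanishes (★ `tangentSheaf_section_eq_zero_iff_of_isAffineOpen`: `Γ(V, Ω¹)` is spanned by the `df`), and a section of
`𝒪_X` vanishing on an affine open cover vanishes. [cite: Hartshorne1977, II Prop. 5.2 (p. 110) and II Remark 8.9.2 (p. 175)] -/
theorem vectorField_eq_zero_of_forall_appLE_dSection_eq_zero
    (hD : ∀ (U : X.left.Opens) (f : Γ(X.left, U)),
      (show Γ(X.left, U) from appLE D (homOfLE le_top) (dSection X U f)) = 0) : D = 0 := by
  -- restrictions to affine opens vanish
  have hV : ∀ (V : X.left.Opens) (hV : IsAffineOpen V), restrictHom (homOfLE (le_top : V ≤ ⊤)) D = 0 := by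
    intro V hV
    refine (tangentSheaf_section_eq_zero_iff_of_isAffineOpen hV _).mpr fun a => ?_
    rw [appLE_restrictHom, Category.id_comp]
    exact hD V a
  refine hom_ext_of_appLE fun W₀ k₀ s => ?_
  rw [appLE_zero]
  -- cover `W₀` by the affine opens inside it; `𝒪_X` is a sheaf
  let J := {V : X.left.affineOpens // V.1 ≤ W₀}
  let U : J → X.left.Opens := fun V => V.1.1
  have hcov : W₀ ≤ iSup U := fun x hx => by
    obtain ⟨_, ⟨V, hV, rfl⟩, hxV, hVW⟩ := X.left.isBasis_affineOpens.exists_subset_of_mem_open hx W₀.isOpen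
    exact Opens.mem_iSup.mpr ⟨⟨⟨V, hV⟩, hVW⟩, hxV⟩
  refine TopCat.Sheaf.eq_of_locally_eq' ((SheafOfModules.toSheaf _).obj (unitModule X.left)) U W₀
    (fun V => homOfLE V.2) hcov _ _ fun V => ?_
  change (unitModule X.left).presheaf.map (homOfLE V.2).op (appLE D k₀ s) =
    (unitModule X.left).presheaf.map (homOfLE V.2).op 0
  rw [map_zero, ← appLE_map,
    show homOfLE V.2 ≫ k₀ = 𝟙 _ ≫ homOfLE (le_top : U V ≤ ⊤) from Subsingleton.elim _ _,
    ← appLE_restrictHom, hV (U V) V.1.2, appLE_zero]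

include happ in
/-- **§4 assembled**: a morphism with the section formula of a global vector field `D` which is the projection has `D = 0`.
[cite: MumfordAV1970, §13, proof of the Theorem (p. 125)] [cite: GortzWedhorn2023, Rem. 27.18 (4)] -/
theorem vectorField_eq_zero_of_flow_eq_fst (hΦ : Φ = fst X (ArtAlg.sqZeroExt (k := k) k).specOver) : D = 0 :=
  vectorField_eq_zero_of_forall_appLE_dSection_eq_zero X D (appLE_dSection_eq_zero_of_flow_eq_fst X D Φ happ hΦ)

end VectorField

/-! ## §5 The core of (δ) -/

section Core

open scoped MonObj

/-- **CORE OF (δ)** — `A` an abelian scheme over a field `k` of characteristic `0`, `L` of rank one, rigidified and fibrewise of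
an ample class, `D` a global vector field with a first-order flow `Φ` (identity on the closed fibre, section formula — the
conclusion of (α)) which is the translation by its value at the origin (the conclusion of (β)) and fixes the class of `L`
(`Φ^*[L] = p^*[L]`, the conclusion of (γ)): then `D = 0`. [cite: MumfordAV1970, §13, proof of the Theorem (pp. 125–130)]
[cite: GortzWedhorn2023, Prop. 27.122 and Rem. 27.18 (4)] -/
theorem vectorField_eq_zero_of_flow_of_cechPic_pullback_eq [CharZero k]
    (A : AbelianSchemeOver (Spec (.of k))) {L : A.left.Modules} (hL : HasRank L 1)
    (hε : CechPic.pullback A.unitSection (detClass (HasRank.isFiniteLocallyFree' hL)) = 1)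
    (hΘ : ∀ ⦃Ω : Type⦄ [Field Ω] [IsAlgClosed Ω] (s : Spec (.of Ω) ⟶ Spec (.of k)),
      ∃ Θ : CartierDivisor (A.fibre s).toAbelianVariety.X.left, Θ.IsAmple ∧
        CechPic.pullback (X := (A.fibre s).toAbelianVariety.X.left) (pullback.fst A.X.hom s)
          (detClass (HasRank.isFiniteLocallyFree' hL)) = Θ.cechClass)
    (D : (cotangentSheaf A.X).over ⊤ ⟶ (unitModule A.X.left).over ⊤)
    (Φ : A.X ⊗ (ArtAlg.sqZeroExt (k := k) k).specOver ⟶ A.X)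
    (h0 : closedFibreι A.X (ArtAlg.sqZeroExt (k := k) k) ≫ Φ.left = 𝟙 A.left)
    (happ : ∀ (U : A.X.left.Opens) (V : (A.X ⊗ (ArtAlg.sqZeroExt (k := k) k).specOver).left.Opens)
        (h₁ : V ≤ Φ.left ⁻¹ᵁ U) (h₂ : V ≤ (fst A.X (ArtAlg.sqZeroExt (k := k) k).specOver).left ⁻¹ᵁ U)
        (f : Γ(A.X.left, U)),
        Φ.left.appLE U V h₁ f =
          (fst A.X (ArtAlg.sqZeroExt (k := k) k).specOver).left.appLE U V h₂ f +
            sectionOn (deformationParam A.X) V *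
              (fst A.X (ArtAlg.sqZeroExt (k := k) k).specOver).left.appLE U V h₂
                (show Γ(A.X.left, U) from appLE D (homOfLE le_top) (dSection A.X U f)))
    (hβ : (A.X ◁ (lift (toUnit _ ≫ η[A.X]) (𝟙 _) ≫ Φ)) ≫ μ[A.X] = Φ)
    (hγ : CechPic.pullback Φ.left (detClass (HasRank.isFiniteLocallyFree' hL)) =
      CechPic.pullback (fst A.X (ArtAlg.sqZeroExt (k := k) k).specOver).left (detClass (HasRank.isFiniteLocallyFree' hL))) :
    D = 0 :=
  vectorField_eq_zero_of_flow_eq_fst A.X D Φ happ (flow_eq_fst_of_cechPic_pullback_eq A hL hε hΘ Φ h0 hβ hγ)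

end Core

end Literature.AlgebraicGeometry.AbelianSchemes

end
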